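import Literature.Probability.LatticeModels.SixVertexPlanarTwoPoint
import Literature.Probability.LatticeModels.SixVertexSpectralMeasureMassBounds
import Literature.Probability.LatticeModels.SixVertexSpectralLimitLemmas

/-!
# Spectral representation of the planar two-point function (DKLM 2026, Part II, Lemma 32 for
# the plane, conditional on the regularity input of Lemma 30)

H. Duminil-Copin, K. K. Kozlowski, P. Lammers, I. Manolescu, *Gaussian free field convergence of
the six-vertex model with `-1 ≤ Δ ≤ -1/2`*, arXiv:2603.06268 (2026) [DKLM2026SixVertexGFF]
(`paper:arxiv-2603.06268`, chunk p0024):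

> **Lemma 32 (Full-plane spectral representation).** Fix a sequence `(L_k)_k` such that `μ_{L_k}`
> converges to some measure `μ_∞` in `𝓜`. Then `μ_∞[{a > 2}] = 0` and for any horizontally
> ordered `u` with `y₁ = 0` or `y₂ = 0` we have `Φ₂(u) = ∫ χ^discr_u(a,b) dμ_∞(a,b)`. *Proof.* By
> Theorem (infinite volume 6V), we have `lim_k Φ_{CYL(L_k),2}|_{D₂} = Φ₂|_{D₂}`. By Lemma 31, it
> suffices to show […]

For the planar slope-zero measure `P` of the statement file (`IsPlanarSixVertexMeasure 1 1 c P`,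
which *is* the infinite-volume limit, so that `lim_L Φ_{CYL(L),2} = Φ₂^P` is
`SixVertexPlanarTwoPoint.lean` and no external input is needed there), and **conditionally on the
regularity displays of Corollary 18** feeding Lemma 30 (hypotheses `hRa`, `hRb`, uniformly in `L`,
as in `SixVertexSpectralMeasureMassBounds.lean`), we assemble:

**there are a subsequence `L_j = 2(φ(j)+1)` and a measure `μ_∞ ∈ 𝓜_{c_reg, C'}` with
`μ_{L_j} → μ_∞` vaguely, `μ_∞{a > 2} = 0`, and `Φ₂^P(u) = ∫ χ^discr_u dμ_∞` for every horizontally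
ordered lattice configuration `u` of two L-shaped pairs with `y₁ = 0` (resp. `y₂ = 0`) and
horizontal gap `≥ 1`** (`IsPlanarSixVertexMeasure.exists_fullPlane_spectralMeasure`).

Ingredients: Lemma 30 (`dklmMeasure_mem_dklmSpaceM_of_regularity`), Lemma 31 (i)
(`dklmSpaceM_exists_subseq_vagueTendsto`), Lemma 32's dominated-convergence step
(`fullPlane_spectral_representation(')`), Theorem 23 (`cylinderPairExp_lPairObs_lPairObs_eq_integral`)
and the planar limit `Φ₂^P = lim_L Φ^{CYL(L)}_2` (`IsPlanarSixVertexMeasure.tendsto_cylinderPairExp_kPoint`).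

## References

* H. Duminil-Copin, K. K. Kozlowski, P. Lammers, I. Manolescu, arXiv:2603.06268 (2026), Part II,
  Lemmas 30–32; Theorem 23; Theorem 2.2. [DKLM2026SixVertexGFF]
-/

noncomputable section

open MeasureTheory Set Filter Topology

namespace Literature.Probability.LatticeModels.SixVertex

/-- The `L`-independent constant of Lemma 30 (`SixVertexSpectralMeasureMassBounds.lean`).
[cite: DKLM2026SixVertexGFF, Part II, Lemma 30] -/
def dklmRegConst (Creg creg : ℝ) : ℝ :=
  max (max (162 * Creg) 256) (2 * (4 / 3 * Creg * Real.pi ^ creg * 2 ^ creg) + 256 * (16 * Real.pi) ^ creg)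

/-- The constant of Lemma 30 is non-negative. [cite: DKLM2026SixVertexGFF, Part II, Lemma 30] -/
theorem dklmRegConst_nonneg (Creg creg : ℝ) : 0 ≤ dklmRegConst Creg creg :=
  le_trans (by norm_num) ((le_max_right _ _).trans (le_max_left _ _))

/-- `μ_L` gives no mass to `{a ≥ 2}` (its atoms lie in `(0,2) × [-π,π]`, Theorem 23).
[cite: DKLM2026SixVertexGFF, Part II, Theorem 23] -/
theorem dklmMeasure_null_two_le (c : ℝ) (hc : 0 < c) (ℓ : ℕ) :
    dklmMeasure c hc ℓ {p : ℝ × ℝ | 2 ≤ p.1} = 0 := by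
  refine measure_mono_null (fun p hp => ?_) (dklmMeasure_compl_support c hc ℓ)
  rw [mem_compl_iff, mem_prod]
  rintro ⟨ha, -⟩
  exact absurd ha.2 (not_lt.2 hp)

/-- **Spectral representation of the planar two-point function** (Lemma 32 for the plane,
conditional on the regularity input of Lemma 30). For the planar slope-zero six-vertex measure `P`
(`a = b = 1`, `c > 0`) and constants `C_reg`, `c_reg > 0` such that the two displays of the
cylinder regularity estimate (Corollary 18) hold at every height `L = 2(ℓ+1)`: there are a
subsequence `φ` and a measure `μ_∞ ∈ 𝓜_{c_reg, C'}` with `μ_{2(φ(j)+1)} → μ_∞` vaguely (on the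
half-plane), `μ_∞{a > 2} = 0`, and, for every horizontally ordered lattice configuration of two
L-shaped pairs with first pair horizontal (`y₁ = 0`) and horizontal gap `x₁' ≥ 1`,
`Φ₂^P(u) = ∫ χ^discr_u dμ_∞`; likewise with the second pair horizontal (`y₂ = 0`).
[cite: DKLM2026SixVertexGFF, Part II, Lemma 32 (with Lemmas 30, 31 and Theorem 23)] -/
theorem IsPlanarSixVertexMeasure.exists_fullPlane_spectralMeasure {c : ℝ} (hc : 0 < c)
    {P : Measure (Config (ℤ × ℤ))} (hP : IsPlanarSixVertexMeasure 1 1 c P) {Creg creg : ℝ} (hcreg : 0 < creg)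
    (hRa : ∀ ℓ m : ℕ, |phiHor c ℓ m| ≤ Creg)
    (hRb : ∀ ℓ m ℓ' : ℕ, 0 < ℓ' → (ℓ' : ℝ) ≤ 8 * ((m : ℝ) + 1) → ℓ' ≤ ℓ + 1 →
      |phiVer c ℓ m ℓ'| ≤ Creg * ((ℓ' : ℝ) / ((m : ℝ) + 1)) ^ creg) :
    ∃ (φ : ℕ → ℕ) (μinf : Measure (ℝ × ℝ)), StrictMono φ ∧ μinf ∈ dklmSpaceM creg (dklmRegConst Creg creg) ∧
      HalfPlaneVagueTendsto (fun j => dklmMeasure c hc (φ j)) μinf ∧ μinf {p : ℝ × ℝ | 2 < p.1} = 0 ∧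
      (∀ (r₁' r₂' a₁ w₁' : ℕ) (h₁ : a₁ + w₁' + 1 ≤ r₁' + 1) (a₂ w₂' : ℕ) (h₂ : a₂ + w₂' + 1 ≤ r₂' + 1)
          (q₂ y₀ y₂ k : ℕ), 1 ≤ r₁' - a₁ - w₁' + k + a₂ →
        ((kPoint P 2 (lPairConfig r₁' a₁ w₁' 0 a₂ w₂' q₂ y₀ y₂ k) : ℝ) : ℂ) =
          ∫ p, chiDiscr (w₁' + 1) 0 (r₁' - a₁ - w₁' + k + a₂) ((y₂ : ℤ) - y₀) (w₂' + 1) q₂ p ∂μinf) ∧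
      (∀ (r₁' r₂' a₁ w₁' : ℕ) (h₁ : a₁ + w₁' + 1 ≤ r₁' + 1) (q₁ a₂ w₂' : ℕ) (h₂ : a₂ + w₂' + 1 ≤ r₂' + 1)
          (y₀ y₂ k : ℕ), 1 ≤ r₁' - a₁ - w₁' + k + a₂ →
        ((kPoint P 2 (lPairConfig r₁' a₁ w₁' q₁ a₂ w₂' 0 y₀ y₂ k) : ℝ) : ℂ) =
          ∫ p, chiDiscr (w₁' + 1) q₁ (r₁' - a₁ - w₁' + k + a₂) ((y₂ : ℤ) - y₀ - q₁) (w₂' + 1) 0 p ∂μinf) := by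
  -- Lemma 30: `μ_L ∈ 𝓜_{c_reg, C'}` uniformly in `L`
  have hM : ∀ ℓ : ℕ, dklmMeasure c hc ℓ ∈ dklmSpaceM creg (dklmRegConst Creg creg) := fun ℓ =>
    dklmMeasure_mem_dklmSpaceM_of_regularity c hc ℓ hcreg.le (hRa ℓ) (hRb ℓ)
  have hC := dklmRegConst_nonneg Creg creg
  -- Lemma 31 (i): a vaguely convergent subsequence
  obtain ⟨φ, hφ, μinf, hμinf, hv⟩ := dklmSpaceM_exists_subseq_vagueTendsto hcreg hC hM
  have hsupp : ∀ j, (dklmMeasure c hc ∘ φ) j {p : ℝ × ℝ | 2 ≤ p.1} = 0 := fun j => dklmMeasure_null_two_le c hc (φ j)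
  refine ⟨φ, μinf, hφ, hμinf, hv, null_Ioi_two_of_halfPlaneVagueTendsto hμinf hv hsupp, ?_, ?_⟩
  · intro r₁' r₂' a₁ w₁' h₁ a₂ w₂' h₂ q₂ y₀ y₂ k hgap
    -- the cylinder two-point functions along the subsequence and their limit `Φ₂^P(u)`
    have hΦ : ∀ j, ((cylinderPairExp c r₁' (lPairObs r₁' a₁ w₁' h₁ 0 ((y₀ : ℕ) : ZMod (2 * (φ j + 1)))) (r₁' + 1 + k) r₂'
        (lPairObs r₂' a₂ w₂' h₂ q₂ ((y₂ : ℕ) : ZMod (2 * (φ j + 1)))) : ℝ) : ℂ) =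
        ∫ p, chiDiscr (w₁' + 1) 0 (r₁' - a₁ - w₁' + k + a₂) ((y₂ : ℤ) - y₀) (w₂' + 1) q₂ p ∂(dklmMeasure c hc ∘ φ) j := by
      intro j
      have := cylinderPairExp_lPairObs_lPairObs_eq_integral c hc (φ j) a₁ w₁' h₁ 0 a₂ w₂' h₂ q₂ y₀ y₂ k
      simpa only [Nat.cast_zero, sub_zero, Function.comp_apply] using this
    have hlim := (hP.tendsto_cylinderPairExp_kPoint hc a₁ w₁' h₁ 0 a₂ w₂' h₂ q₂ y₀ y₂ k).comp hφ.tendsto_atTop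
    exact (fullPlane_spectral_representation hcreg hC (fun j => hM (φ j)) hμinf hv hsupp (w₁' + 1) hgap
      ((y₂ : ℤ) - y₀) (w₂' + 1) (q₂ : ℤ) hΦ hlim).2
  · intro r₁' r₂' a₁ w₁' h₁ q₁ a₂ w₂' h₂ y₀ y₂ k hgap
    have hΦ : ∀ j, ((cylinderPairExp c r₁' (lPairObs r₁' a₁ w₁' h₁ q₁ ((y₀ : ℕ) : ZMod (2 * (φ j + 1)))) (r₁' + 1 + k) r₂'
        (lPairObs r₂' a₂ w₂' h₂ 0 ((y₂ : ℕ) : ZMod (2 * (φ j + 1)))) : ℝ) : ℂ) =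
        ∫ p, chiDiscr (w₁' + 1) q₁ (r₁' - a₁ - w₁' + k + a₂) ((y₂ : ℤ) - y₀ - q₁) (w₂' + 1) 0 p ∂(dklmMeasure c hc ∘ φ) j := by
      intro j
      have := cylinderPairExp_lPairObs_lPairObs_eq_integral c hc (φ j) a₁ w₁' h₁ q₁ a₂ w₂' h₂ 0 y₀ y₂ k
      simpa only [Nat.cast_zero, Function.comp_apply] using this
    have hlim := (hP.tendsto_cylinderPairExp_kPoint hc a₁ w₁' h₁ q₁ a₂ w₂' h₂ 0 y₀ y₂ k).comp hφ.tendsto_atTop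
    exact (fullPlane_spectral_representation' hcreg hC (fun j => hM (φ j)) hμinf hv hsupp (w₁' + 1) (q₁ : ℤ) hgap
      ((y₂ : ℤ) - y₀ - q₁) (w₂' + 1) hΦ hlim).2

end Literature.Probability.LatticeModels.SixVertex

end
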